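import Literature.NumberTheory.ConnesConsani2021.QuasiInnerProducts
import HarnessLib

/-!
# Connes–Consani 2021 (JNT) §4.3 — the term `ℰ_∞` of Theorem 4.4 (ii) (bricks)

LINE 1 — LABEL: RH-FREE corpus literature (the norm-convergent rank-one series
`ℰ_∞ = Σ_{n≥1} (−1)^n 2π^{2n+½}(1 − p^{−(2n+1)})((4n+1)(p^{2n}−1)Γ(n+1)Γ(n+½))^{−1}|ξ_n⟩⟨η_n|` and the
identification of its coefficients with the residues of `ρ_∞ρ_p` at `−2n`); bears_on: W-C/W-P (P5 sequel
vocabulary, no leaf role); WHAT THIS IS NOT: any claim about RH — nothing in this file bears on the truth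
of RH.

Source: A. Connes, C. Consani, *Quasi-inner functions and local factors*, J. Number Theory **226**
(2021) 139–167 = arXiv:2008.10974 [bib: `ConnesConsani2021QuasiInner`], Theorem 4.4 (ii) eq. (4.3) and
its proof (arXiv chunks p0011:L89–L100, p0012:L1–L3: «For the non-zero poles of `ρ_∞` this multiplies the
residue by `ρ_p(−2n) = (1 − p^{−(2n+1)})/(1 − p^{2n})` which does not alter the strong convergence of
(uinftyoff1) in Theorem 2.3 and gives (uinftypoff1)»). THEOREMS ONLY; vocabulary = `QuasiInnerLocalFactors`
(`xiVec`, `etaVec`, `xArch`, `alphaArch`, `thm23Coeff`, `rhoPrime`, `cayleyInv`) and row t18's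
`QuasiInnerProducts` (`thm44Coeff`, `thm44Coeff_eq_thm23Coeff_mul`; the bound `|c_n(p)| ≤ 4√π π^{2n}/n!`
is row t18's `abs_thm44Coeff_le` in `QuasiInnerPrimePolarPart.lean`, re-derived here privately to keep the
import light).

## Content (RH-FREE)

* `rhoPrime_neg_two_mul_nat` — `ρ_p(−2n) = (1 − p^{−(2n+1)})/(1 − p^{2n})` (`n ≥ 1`).
* `archRes_mul_rhoPrime_kernel_eq` — the residue of `ρ_∞ρ_pR_j` at `−2n` is
  `ρ_p(−2n)·α(n)·x(n)^j` (`α(n)`, `x(n)` of display «aminusk»).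
* `thm44Coeff_smul_rankOne` — `c^{(p)}_n|ξ_n⟩⟨η_n| = (ρ_p(−2n)α(n))|ξ_{x_n}⟩⟨η_{x_n}|` with the unit
  vectors `ξ_n, η_n` and the coefficient `c^{(p)}_n` of eq. (4.3) (`thm44Coeff p n`).
* `summable_thm44_rankOne`, `hasSum_thm44_rankOne_tsum` — the series (4.3) converges in operator norm.
* `inner_fourierLp_tsum_thm44_rankOne` — its matrix in the Fourier basis: entry `(−k−1, b)`, `b ≥ 0`, is
  `Σ_{n≥1} ρ_p(−2n)α(n)x(n)^{k+b}`; rows `a ≥ 0` and columns `b < 0` vanish.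

Nothing in this file bears on the truth of RH.
-/

noncomputable section

open _root_.MeasureTheory _root_.Complex AddCircle Filter Set
open scoped Real Topology Nat InnerProductSpace ComplexConjugate

namespace Literature.NumberTheory.ConnesConsani2021

namespace QuasiInner

/-! ### The value `ρ_p(−2n)` and the residues at `−2n` -/

/-- **`ρ_p(−2n) = (1 − p^{−(2n+1)})/(1 − p^{2n})`** («this multiplies the residue by `ρ_p(−2n) = …`»).
[cite: ConnesConsani2021QuasiInner, Thm 4.4 (ii) proof (arXiv chunk p0012:L1–L2)] -/
theorem rhoPrime_neg_two_mul_nat {p : ℕ} (hp : 1 < p) (n : ℕ) :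
    rhoPrime p (-(2 * (n : ℂ))) =
      ((((1 - ((p : ℝ) ^ (2 * n + 1))⁻¹) / (1 - (p : ℝ) ^ (2 * n))) : ℝ) : ℂ) := by
  have hp0 : (p : ℂ) ≠ 0 := Nat.cast_ne_zero.2 (by omega)
  rw [rhoPrime]
  have h1 : (p : ℂ) ^ (-(2 * (n : ℂ)) - 1) = ((p : ℂ) ^ (2 * n + 1))⁻¹ := by
    rw [show (-(2 * (n : ℂ)) - 1) = -(((2 * n + 1 : ℕ) : ℂ)) by push_cast; ring, cpow_neg,
      cpow_natCast]
  have h2 : (p : ℂ) ^ (-(-(2 * (n : ℂ)))) = (p : ℂ) ^ (2 * n) := by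
    rw [neg_neg, show (2 * (n : ℂ)) = (((2 * n : ℕ)) : ℂ) by push_cast; ring, cpow_natCast]
  rw [h1, h2]
  push_cast
  ring

/-- **The residue of `ρ_∞ρ_pR_j` at `−2n` is `ρ_p(−2n)·α(n)·x(n)^j`**: `r_n·(−8)/(4n+3)² = α(n)`
(`r_n = (−1)^n2√π π^{2n}/(n!Γ(n+½))` the residue of `ρ_∞`, `α(n)` of display «aminusk») and
`ψ⁻¹(−2n) = x(n)`. [cite: ConnesConsani2021QuasiInner, Thm 4.4 (ii) proof (arXiv chunk p0012:L1–L3) with §2 (p0005:L94–L115)] -/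
theorem archRes_mul_rhoPrime_kernel_eq (p : ℕ) (n j : ℕ) :
    ((((-1 : ℝ) ^ n * 2 * (Real.sqrt π * π ^ (2 * n)) / (n ! * Real.Gamma (n + 1 / 2)) : ℝ)) : ℂ) *
        (rhoPrime p (-(2 * (n : ℂ))) *
          (cayleyInv (-(2 * (n : ℂ))) ^ j * ((-8 : ℂ) / (2 * (-(2 * (n : ℂ))) - 3) ^ 2))) =
      rhoPrime p (-(2 * (n : ℂ))) * ((alphaArch n : ℂ) * (xArch n : ℂ) ^ j) := by
  rw [← xArch_eq_cayleyInv]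
  have hG2 : Real.Gamma ((n : ℝ) + 1 / 2) ≠ 0 := (Real.Gamma_pos_of_pos (by positivity)).ne'
  have hfac : ((n ! : ℕ) : ℝ) ≠ 0 := by positivity
  have h43 : (2 * (-(2 * (n : ℂ))) - 3) ≠ 0 := by
    intro h
    have := congrArg Complex.re h
    simp at this
    linarith [n.cast_nonneg (α := ℝ)]
  have key : ((-1 : ℝ) ^ n * 2 * (Real.sqrt π * π ^ (2 * n)) / (n ! * Real.Gamma (n + 1 / 2))) *
      (-8 / (4 * n + 3) ^ 2) = alphaArch n := by
    unfold alphaArch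
    rw [Real.Gamma_nat_eq_factorial]
    have h43r : (4 * (n : ℝ) + 3) ≠ 0 := by positivity
    field_simp
    ring
  rw [← key]
  have e : ((-8 : ℂ) / (2 * (-(2 * (n : ℂ))) - 3) ^ 2) = (((-8 / (4 * n + 3) ^ 2 : ℝ)) : ℂ) := by
    push_cast
    congr 1
    ring
  rw [e]
  push_cast
  ring

/-! ### The coefficients of eq. (4.3) and the unit vectors -/

/-- **`c^{(p)}_n|ξ_n⟩⟨η_n| = (ρ_p(−2n)α(n))|ξ_{x_n}⟩⟨η_{x_n}|`** (`n ≥ 1`): the coefficient of eq. (4.3)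
times the rank-one operator of the UNIT vectors equals the residue coefficient times the rank-one operator
of `ξ_{x_n}, η_{x_n}` (t18's `thm44Coeff_eq_thm23Coeff_mul`, g1's `alphaArch_smul_rankOne`).
[cite: ConnesConsani2021QuasiInner, Thm 4.4 (ii) eq. (4.3) and proof (arXiv chunk p0011:L89–L93, p0012:L1–L3)] -/
theorem thm44Coeff_smul_rankOne {p : ℕ} (hp : 2 ≤ p) {n : ℕ} (hn : 1 ≤ n) :
    (thm44Coeff p n : ℂ) •
        InnerProductSpace.rankOne ℂ ((‖xiVec 1 (xArch n : ℂ)‖⁻¹ : ℂ) • xiVec 1 (xArch n : ℂ))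
          ((‖etaVec 1 (xArch n : ℂ)‖⁻¹ : ℂ) • etaVec 1 (xArch n : ℂ)) =
      (rhoPrime p (-(2 * (n : ℂ))) * (alphaArch n : ℂ)) •
        InnerProductSpace.rankOne ℂ (xiVec 1 (xArch n : ℂ)) (etaVec 1 (xArch n : ℂ)) := by
  have hp1 : 1 < p := by omega
  rw [mul_smul, alphaArch_smul_rankOne n, smul_smul, thm44Coeff_eq_thm23Coeff_mul hp hn,
    rhoPrime_neg_two_mul_nat hp1 n]
  push_cast
  ring_nf

/-- The unit vectors have norm one (`ξ_{x_n} ≠ 0`). [folklore] -/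
private theorem pa_norm_unit {v : Lp ℂ 2 (haarAddCircle (T := (1 : ℝ)))} (hv : v ≠ 0) :
    ‖((‖v‖⁻¹ : ℂ) • v)‖ = 1 := by
  rw [norm_smul, show ((‖v‖⁻¹ : ℂ)) = (((‖v‖⁻¹ : ℝ)) : ℂ) by push_cast; rfl, Complex.norm_real,
    Real.norm_eq_abs, abs_of_nonneg (by positivity), inv_mul_cancel₀ (norm_ne_zero_iff.2 hv)]

/-- `ξ_x ≠ 0` and `η_x ≠ 0` for `|x| < 1`. [folklore] -/
private theorem pa_xiVec_ne_zero (n : ℕ) :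
    xiVec 1 (xArch n : ℂ) ≠ 0 ∧ etaVec 1 (xArch n : ℂ) ≠ 0 := by
  have hx : ‖(xArch n : ℂ)‖ < 1 := by
    rw [Complex.norm_real, Real.norm_eq_abs]; exact xArch_lt_one n
  have hpos : 0 < (1 - ‖(xArch n : ℂ)‖ ^ 2)⁻¹ := by
    have : ‖(xArch n : ℂ)‖ ^ 2 < 1 := by nlinarith [norm_nonneg (xArch n : ℂ)]
    exact inv_pos.2 (by linarith)
  constructor
  · intro h
    have := norm_xiVec_sq (T := 1) _ hx
    rw [h, norm_zero] at this
    linarith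
  · intro h
    have := norm_etaVec_sq (T := 1) _ hx
    rw [h, norm_zero] at this
    linarith

/-- `|c_n(p)| ≤ 4√π π^{2n}/n!` (`p ≥ 2`, `n ≥ 1`) — row t18's `abs_thm44Coeff_le`, re-derived.
[cite: ConnesConsani2021QuasiInner, Thm 4.4 proof (arXiv chunk p0012:L7); Thm 2.3 (p0006:L49)] -/
private theorem pa_abs_thm44Coeff_le {p n : ℕ} (hp : 2 ≤ p) (hn : 1 ≤ n) :
    |thm44Coeff p n| ≤ 4 * Real.sqrt π * (π ^ 2) ^ n / n ! := by
  rw [thm44Coeff_eq_thm23Coeff_mul hp hn, abs_mul]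
  have hp1 : (1 : ℝ) < (p : ℝ) ^ (2 * n) := one_lt_pow₀ (by exact_mod_cast hp) (by omega)
  have hp2 : (1 : ℝ) < (p : ℝ) ^ (2 * n + 1) := one_lt_pow₀ (by exact_mod_cast hp) (by omega)
  have hF : |(1 - ((p : ℝ) ^ (2 * n + 1))⁻¹) / (1 - (p : ℝ) ^ (2 * n))| ≤ 1 := by
    rw [abs_div, abs_of_nonneg (by rw [sub_nonneg]; exact inv_le_one_of_one_le₀ hp2.le),
      abs_of_neg (by linarith), div_le_one (by linarith)]
    have : 0 ≤ ((p : ℝ) ^ (2 * n + 1))⁻¹ := by positivity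
    have h3 : (3 : ℝ) ≤ (p : ℝ) ^ (2 * n) - 1 := by
      have h4 : (4 : ℝ) ≤ (p : ℝ) ^ (2 * n) := by
        calc (4 : ℝ) = 2 ^ 2 := by norm_num
          _ ≤ (p : ℝ) ^ 2 := by gcongr; exact_mod_cast hp
          _ ≤ (p : ℝ) ^ (2 * n) := pow_le_pow_right₀ (by exact_mod_cast (by omega : 1 ≤ p)) (by omega)
      linarith
    linarith
  calc |thm23Coeff n| * |(1 - ((p : ℝ) ^ (2 * n + 1))⁻¹) / (1 - (p : ℝ) ^ (2 * n))|
      ≤ |thm23Coeff n| * 1 := mul_le_mul_of_nonneg_left hF (abs_nonneg _)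
    _ ≤ 4 * Real.sqrt π * (π ^ 2) ^ n / n ! := by rw [mul_one]; exact abs_thm23Coeff_le n

/-- **The series (4.3) converges in operator norm** («does not alter the strong convergence of
(uinftyoff1)»: `|c^{(p)}_n| ≤ 4√π π^{2n}/n!`, t18's `abs_thm44Coeff_le`, and `‖|ξ_n⟩⟨η_n|‖ = 1`).
[cite: ConnesConsani2021QuasiInner, Thm 4.4 (ii) eq. (4.3) (arXiv chunk p0011:L89–L93; proof p0012:L1–L3)] -/
theorem summable_thm44_rankOne {p : ℕ} (hp : p.Prime) :
    Summable fun n : ℕ => (thm44Coeff p (n + 1) : ℂ) •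
      InnerProductSpace.rankOne ℂ
        ((‖xiVec 1 (xArch (n + 1) : ℂ)‖⁻¹ : ℂ) • xiVec 1 (xArch (n + 1) : ℂ))
        ((‖etaVec 1 (xArch (n + 1) : ℂ)‖⁻¹ : ℂ) • etaVec 1 (xArch (n + 1) : ℂ)) := by
  have hmaj : Summable fun n : ℕ => 4 * Real.sqrt π * (π ^ 2) ^ (n + 1) / ((n + 1) ! : ℝ) := by
    have h0 := Real.summable_pow_div_factorial (π ^ 2)
    have h1 : Summable fun n : ℕ => (π ^ 2) ^ (n + 1) / ((n + 1) ! : ℝ) :=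
      (summable_nat_add_iff 1).2 h0
    refine (h1.mul_left (4 * Real.sqrt π)).congr fun n => ?_
    ring
  refine Summable.of_norm_bounded hmaj fun n => ?_
  obtain ⟨hξ, hη⟩ := pa_xiVec_ne_zero (n + 1)
  rw [norm_smul, InnerProductSpace.norm_rankOne, pa_norm_unit hξ, pa_norm_unit hη, mul_one, mul_one,
    Complex.norm_real, Real.norm_eq_abs]
  exact_mod_cast pa_abs_thm44Coeff_le hp.two_le (by omega : 1 ≤ n + 1)

/-- The sum `ℰ_∞` of the series (4.3) (as `∑'`) is its `HasSum` limit.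
[cite: ConnesConsani2021QuasiInner, Thm 4.4 (ii) eq. (4.3) (arXiv chunk p0011:L89–L93)] -/
theorem hasSum_thm44_rankOne_tsum {p : ℕ} (hp : p.Prime) :
    HasSum (fun n : ℕ => (thm44Coeff p (n + 1) : ℂ) •
      InnerProductSpace.rankOne ℂ
        ((‖xiVec 1 (xArch (n + 1) : ℂ)‖⁻¹ : ℂ) • xiVec 1 (xArch (n + 1) : ℂ))
        ((‖etaVec 1 (xArch (n + 1) : ℂ)‖⁻¹ : ℂ) • etaVec 1 (xArch (n + 1) : ℂ)))
      (∑' n : ℕ, (thm44Coeff p (n + 1) : ℂ) •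
        InnerProductSpace.rankOne ℂ
          ((‖xiVec 1 (xArch (n + 1) : ℂ)‖⁻¹ : ℂ) • xiVec 1 (xArch (n + 1) : ℂ))
          ((‖etaVec 1 (xArch (n + 1) : ℂ)‖⁻¹ : ℂ) • etaVec 1 (xArch (n + 1) : ℂ))) :=
  (summable_thm44_rankOne hp).hasSum

/-! ### The matrix of `ℰ_∞` in the Fourier basis -/

/-- **The matrix of `ℰ_∞`**: if `E` is the sum of the series (4.3) then
`⟨e_{−k−1} | E e_b⟩ = Σ_{n≥0} ρ_p(−2(n+1))α(n+1)x(n+1)^{k+b}` for `b ≥ 0`, `⟨e_a | E v⟩ = 0` for `a ≥ 0`,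
and `E e_{−m−1} = 0` (`⟨e_{−k−1}|ξ_x⟩ = x^k`, `⟨η_x|e_b⟩ = x^b` for real `x`, `⟨e_a|ξ_x⟩ = 0`,
`⟨η_x|e_{−m−1}⟩ = 0`). [cite: ConnesConsani2021QuasiInner, Thm 4.4 (ii) proof (arXiv chunk p0011:L100–p0012:L3) with Lemma 2.2 (p0006:L30–L41)] -/
theorem inner_fourierLp_tsum_thm44_rankOne {p : ℕ} (hp : p.Prime)
    {E : Lp ℂ 2 (haarAddCircle (T := 1)) →L[ℂ] Lp ℂ 2 (haarAddCircle (T := 1))}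
    (hE : HasSum (fun n : ℕ => (thm44Coeff p (n + 1) : ℂ) •
      InnerProductSpace.rankOne ℂ
        ((‖xiVec 1 (xArch (n + 1) : ℂ)‖⁻¹ : ℂ) • xiVec 1 (xArch (n + 1) : ℂ))
        ((‖etaVec 1 (xArch (n + 1) : ℂ)‖⁻¹ : ℂ) • etaVec 1 (xArch (n + 1) : ℂ))) E) :
    (∀ k b : ℕ, HasSum (fun n : ℕ => rhoPrime p (-(2 * ((n + 1 : ℕ) : ℂ))) *
        ((alphaArch (n + 1) : ℂ) * (xArch (n + 1) : ℂ) ^ (k + b)))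
      ⟪fourierLp (T := 1) 2 (-(k + 1 : ℤ)), E (fourierLp (T := 1) 2 (b : ℤ))⟫_ℂ) ∧
    (∀ (a : ℕ) (v : Lp ℂ 2 (haarAddCircle (T := 1))), ⟪fourierLp (T := 1) 2 (a : ℤ), E v⟫_ℂ = 0) ∧
    (∀ m : ℕ, E (fourierLp (T := 1) 2 (-(m + 1 : ℤ))) = 0) := by
  have hp2 : 2 ≤ p := hp.two_le
  -- rewrite the terms with `ξ_{x_n}, η_{x_n}`
  have hterm : ∀ n : ℕ, (thm44Coeff p (n + 1) : ℂ) •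
      InnerProductSpace.rankOne ℂ
        ((‖xiVec 1 (xArch (n + 1) : ℂ)‖⁻¹ : ℂ) • xiVec 1 (xArch (n + 1) : ℂ))
        ((‖etaVec 1 (xArch (n + 1) : ℂ)‖⁻¹ : ℂ) • etaVec 1 (xArch (n + 1) : ℂ)) =
      (rhoPrime p (-(2 * ((n + 1 : ℕ) : ℂ))) * (alphaArch (n + 1) : ℂ)) •
        InnerProductSpace.rankOne ℂ (xiVec 1 (xArch (n + 1) : ℂ)) (etaVec 1 (xArch (n + 1) : ℂ)) :=
    fun n => thm44Coeff_smul_rankOne hp2 (by omega)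
  simp_rw [hterm] at hE
  have hx : ∀ n : ℕ, ‖(xArch n : ℂ)‖ < 1 := fun n => by
    rw [Complex.norm_real, Real.norm_eq_abs]; exact xArch_lt_one n
  -- evaluation on a vector
  have hEv : ∀ v, HasSum (fun n : ℕ => ((rhoPrime p (-(2 * ((n + 1 : ℕ) : ℂ))) * (alphaArch (n + 1) : ℂ)) *
      ⟪etaVec 1 (xArch (n + 1) : ℂ), v⟫_ℂ) • xiVec 1 (xArch (n + 1) : ℂ)) (E v) := by
    intro v
    have h := (ContinuousLinearMap.apply ℂ (Lp ℂ 2 (haarAddCircle (T := 1))) v).hasSum hE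
    simp only [ContinuousLinearMap.apply_apply, FunLike.coe_smul, Pi.smul_apply,
      InnerProductSpace.rankOne_apply, smul_smul] at h
    exact h
  refine ⟨fun k b => ?_, fun a v => ?_, fun m => ?_⟩
  · have hterm2 : ∀ n : ℕ, ⟪fourierLp (T := 1) 2 (-(k + 1 : ℤ)),
        ((rhoPrime p (-(2 * ((n + 1 : ℕ) : ℂ))) * (alphaArch (n + 1) : ℂ)) *
          ⟪etaVec 1 (xArch (n + 1) : ℂ), fourierLp (T := 1) 2 (b : ℤ)⟫_ℂ) • xiVec 1 (xArch (n + 1) : ℂ)⟫_ℂ =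
        rhoPrime p (-(2 * ((n + 1 : ℕ) : ℂ))) * ((alphaArch (n + 1) : ℂ) * (xArch (n + 1) : ℂ) ^ (k + b)) := by
      intro n
      rw [inner_smul_right, inner_fourierLp_negSucc_xiVec 1 _ (hx _) k, ← inner_conj_symm,
        inner_fourierLp_natCast_etaVec _ (hx _) b, map_pow, Complex.conj_conj, pow_add]
      ring
    have h := (innerSL ℂ (fourierLp (T := 1) 2 (-(k + 1 : ℤ)))).hasSum
      (hEv (fourierLp (T := 1) 2 (b : ℤ)))
    simp only [innerSL_apply_apply, hterm2] at h
    exact h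
  · have hterm3 : ∀ n : ℕ, ⟪fourierLp (T := 1) 2 (a : ℤ),
        ((rhoPrime p (-(2 * ((n + 1 : ℕ) : ℂ))) * (alphaArch (n + 1) : ℂ)) *
          ⟪etaVec 1 (xArch (n + 1) : ℂ), v⟫_ℂ) • xiVec 1 (xArch (n + 1) : ℂ)⟫_ℂ = 0 := by
      intro n
      rw [inner_smul_right, inner_fourierLp_natCast_xiVec 1 _ (hx _) a, mul_zero]
    have h := (innerSL ℂ (fourierLp (T := 1) 2 (a : ℤ))).hasSum (hEv v)
    simp only [innerSL_apply_apply, hterm3] at h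
    exact h.unique hasSum_zero
  · have hterm4 : ∀ n : ℕ, ((rhoPrime p (-(2 * ((n + 1 : ℕ) : ℂ))) * (alphaArch (n + 1) : ℂ)) *
          ⟪etaVec 1 (xArch (n + 1) : ℂ), fourierLp (T := 1) 2 (-(m + 1 : ℤ))⟫_ℂ) •
        xiVec 1 (xArch (n + 1) : ℂ) = 0 := by
      intro n
      rw [← inner_conj_symm, inner_fourierLp_negSucc_etaVec _ (hx _) m, map_zero, mul_zero, zero_smul]
    have h := hEv (fourierLp (T := 1) 2 (-(m + 1 : ℤ)))
    simp only [hterm4] at h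
    exact h.unique hasSum_zero

end QuasiInner

end Literature.NumberTheory.ConnesConsani2021

end
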